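import Summits.Ventures.HodgeRepro2.T5InertSelfDualUnique
import Summits.Ventures.HodgeRepro2.T5CMInertPlacePackage
import Summits.Ventures.HodgeRepro2.T5CMCensusPackage

/-!
# The self-dual lattice at an inert place from the global data alone, and for CM fields
(cell pub-hodge-repro2, seat p3)

Tier-5 N3 support. Files 181–182 state the `antidiag(1, 1, 1)` normal form of a unimodular hermitian lattice of
rank `3` and the `U(H)`-conjugacy of any two self-dual lattices under seat p8's LOCAL hypothesis set
(`[L_w : K_v] = 2`, a uniformiser of `O_Kv` irreducible in `O_Lw`). Here, exactly as p8's T5-158 / T5-168 do for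
the isotropy and the Hecke package, the local hypotheses are replaced by the GLOBAL ones — `[L : K] = 2` and
`v 𝒪_L = w` («`v` stays prime», p8's T5-157 `finrank_adicCompletion_eq_two_of_staysPrime` /
`irreducible_algebraMap_of_staysPrime`) — and then by Mathlib's CM vocabulary (`[NumberField.IsCMField E]`,
`E⁺ = maximalRealSubfield E`, p8's T5-168 `finrank_eq_two_cm` / `finrank_adicCompletion_eq_two`; the star on
that derived local degree):
* `exists_congruent_J3_one_of_staysPrime`, `exists_isometry_image_stdLattice_eq_of_staysPrime`;
* `exists_congruent_J3_one_of_inert`, `exists_isometry_image_stdLattice_eq_of_inert` (CM fields);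
* `exists_congruent_J3_one_of_not_isSquare`, `exists_isometry_image_stdLattice_eq_of_not_isSquare` (the place
  sorted by the Legendre symbol, p8's T5-179 `map_eq_asIdeal`: `x² = d`, `4d ∉ v`, `d` a non-square mod `v`).
The star is p8's `starRingOfQuadratic` on the derived local degree, by `letI`, as in T5-158 / T5-168.

Mathlib + this seat's files 181–182 + seat p8's T5-157 / T5-158 / T5-168 / T5-179 and their imports; no display; no device.
§8(d): uses an L-value-free non-vanishing device: NO.
-/

namespace Summit.Ventures.HodgeRepro2.T5InertSelfDualGlobal

open Matrix IsDedekindDomain IsDedekindDomain.HeightOneSpectrum NumberField Module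
open Summit.Ventures.HodgeRepro2.T5IntegralUnits Summit.Ventures.HodgeRepro2.T5HermitianThreeElements
  Summit.Ventures.HodgeRepro2.T5UnitaryGroupIsometry Summit.Ventures.HodgeRepro2.T5StarOfInvolution
  Summit.Ventures.HodgeRepro2.T5InertGlobalPrime Summit.Ventures.HodgeRepro2.T5CMInertPlacePackage
  Summit.Ventures.HodgeRepro2.T5InertSelfDualNormalForm Summit.Ventures.HodgeRepro2.T5InertSelfDualUnique

/-! ## From the global data: `[L : K] = 2` and `v 𝒪_L = w` -/

section StaysPrime

variable {K : Type*} [Field K] [NumberField K] (v : HeightOneSpectrum (𝓞 K))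
variable {L : Type*} [Field L] [NumberField L] [Algebra K L]
variable (w : HeightOneSpectrum (𝓞 L)) [w.asIdeal.LiesOver v.asIdeal]

/-- **The normal form `antidiag(1, 1, 1)` from the global data**: `[L : K] = 2`, `v 𝒪_L = w`, a uniformiser `ϖ`
of `O_Kv`, the conjugation `σ ≠ 1` (star = `starRingOfQuadratic` on the derived `[L_w : K_v] = 2`): every
`σ`-hermitian `3 × 3` `H` over `L_w` with entries and inverse in `𝒪_{E_v}` and `IsUnit H.det` is
`Pᴴ H P = antidiag(1, 1, 1)` with `P ∈ GL₃(𝒪_{E_v})` — file 181 on p8's T5-157. -/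
theorem exists_congruent_J3_one_of_staysPrime (h2 : finrank K L = 2)
    (hmap : Ideal.map (algebraMap (𝓞 K) (𝓞 L)) v.asIdeal = w.asIdeal)
    {ϖ : v.adicCompletionIntegers K} (hϖ : Irreducible ϖ)
    (σ : w.adicCompletion L ≃ₐ[v.adicCompletion K] w.adicCompletion L) (hσ : σ ≠ 1)
    {H : Matrix (Fin 3) (Fin 3) (w.adicCompletion L)}
    (hH : letI := starRingOfQuadratic (finrank_adicCompletion_eq_two_of_staysPrime v w h2 hmap) σ hσ
      H.IsHermitian)
    (hint : ∀ i j, IsLocalization.IsInteger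
      (integralClosure (v.adicCompletionIntegers K) (w.adicCompletion L)) (H i j))
    (hdet : IsUnit H.det)
    (hinv : ∀ i j, IsLocalization.IsInteger
      (integralClosure (v.adicCompletionIntegers K) (w.adicCompletion L)) (H⁻¹ i j)) :
    letI := starRingOfQuadratic (finrank_adicCompletion_eq_two_of_staysPrime v w h2 hmap) σ hσ
    ∃ P : Matrix (Fin 3) (Fin 3) (w.adicCompletion L),
      (∀ i j, IsLocalization.IsInteger
        (integralClosure (v.adicCompletionIntegers K) (w.adicCompletion L)) (P i j)) ∧
      IsRUnit (integralClosure (v.adicCompletionIntegers K) (w.adicCompletion L)) P.det ∧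
      P.conjTranspose * H * P = J3 1 :=
  exists_congruent_J3_one_adicCompletion v w (finrank_adicCompletion_eq_two_of_staysPrime v w h2 hmap) hϖ
    (irreducible_algebraMap_of_staysPrime v w hmap hϖ) σ hσ hH hint hdet hinv

/-- **Any two self-dual lattices are `U(H)`-conjugate, from the global data** (`[L : K] = 2`, `v 𝒪_L = w`):
file 182 on p8's T5-157. -/
theorem exists_isometry_image_stdLattice_eq_of_staysPrime (h2 : finrank K L = 2)
    (hmap : Ideal.map (algebraMap (𝓞 K) (𝓞 L)) v.asIdeal = w.asIdeal)
    {ϖ : v.adicCompletionIntegers K} (hϖ : Irreducible ϖ)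
    (σ : w.adicCompletion L ≃ₐ[v.adicCompletion K] w.adicCompletion L) (hσ : σ ≠ 1)
    {H : Matrix (Fin 3) (Fin 3) (w.adicCompletion L)}
    (hH : letI := starRingOfQuadratic (finrank_adicCompletion_eq_two_of_staysPrime v w h2 hmap) σ hσ
      H.IsHermitian)
    (hdet : IsUnit H.det)
    {Q₁ Q₂ : Matrix (Fin 3) (Fin 3) (w.adicCompletion L)} (hQ₁ : IsUnit Q₁) (hQ₂ : IsUnit Q₂)
    (h₁ : letI := starRingOfQuadratic (finrank_adicCompletion_eq_two_of_staysPrime v w h2 hmap) σ hσ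
      dualLattice (integralClosure (v.adicCompletionIntegers K) (w.adicCompletion L))
        (Q₁.conjTranspose * H * Q₁)
        (stdLattice (integralClosure (v.adicCompletionIntegers K) (w.adicCompletion L))) =
      stdLattice (integralClosure (v.adicCompletionIntegers K) (w.adicCompletion L)))
    (h₂ : letI := starRingOfQuadratic (finrank_adicCompletion_eq_two_of_staysPrime v w h2 hmap) σ hσ
      dualLattice (integralClosure (v.adicCompletionIntegers K) (w.adicCompletion L))
        (Q₂.conjTranspose * H * Q₂)
        (stdLattice (integralClosure (v.adicCompletionIntegers K) (w.adicCompletion L))) =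
      stdLattice (integralClosure (v.adicCompletionIntegers K) (w.adicCompletion L))) :
    letI := starRingOfQuadratic (finrank_adicCompletion_eq_two_of_staysPrime v w h2 hmap) σ hσ
    ∃ g : Matrix (Fin 3) (Fin 3) (w.adicCompletion L), g.conjTranspose * H * g = H ∧
      (fun x => g *ᵥ x) '' ((fun x => Q₂ *ᵥ x) ''
          stdLattice (integralClosure (v.adicCompletionIntegers K) (w.adicCompletion L))) =
        (fun x => Q₁ *ᵥ x) ''
          stdLattice (integralClosure (v.adicCompletionIntegers K) (w.adicCompletion L)) :=
  exists_isometry_image_stdLattice_eq v w (finrank_adicCompletion_eq_two_of_staysPrime v w h2 hmap) hϖ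
    (irreducible_algebraMap_of_staysPrime v w hmap hϖ) σ hσ hH hdet hQ₁ hQ₂ h₁ h₂

end StaysPrime

/-! ## CM fields: `E` over `E⁺ = maximalRealSubfield E`, `v 𝒪_E = w` -/

section CM

variable (E : Type*) [Field E] [NumberField E] [IsCMField E]
variable (v : HeightOneSpectrum (𝓞 (maximalRealSubfield E))) (w : HeightOneSpectrum (𝓞 E))
  [w.asIdeal.LiesOver v.asIdeal]

/-- **The normal form `antidiag(1, 1, 1)` for a CM field** `E` over `E⁺` at a place `v` with `v 𝒪_E = w` —
`exists_congruent_J3_one_of_staysPrime` with p8's T5-168 `finrank_eq_two_cm`. -/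
theorem exists_congruent_J3_one_of_inert
    (hmap : Ideal.map (algebraMap (𝓞 (maximalRealSubfield E)) (𝓞 E)) v.asIdeal = w.asIdeal)
    {ϖ : v.adicCompletionIntegers (maximalRealSubfield E)} (hϖ : Irreducible ϖ)
    (σ : w.adicCompletion E ≃ₐ[v.adicCompletion (maximalRealSubfield E)] w.adicCompletion E) (hσ : σ ≠ 1)
    {H : Matrix (Fin 3) (Fin 3) (w.adicCompletion E)}
    (hH : letI := starRingOfQuadratic (finrank_adicCompletion_eq_two E v w hmap) σ hσ; H.IsHermitian)
    (hint : ∀ i j, IsLocalization.IsInteger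
      (integralClosure (v.adicCompletionIntegers (maximalRealSubfield E)) (w.adicCompletion E)) (H i j))
    (hdet : IsUnit H.det)
    (hinv : ∀ i j, IsLocalization.IsInteger
      (integralClosure (v.adicCompletionIntegers (maximalRealSubfield E)) (w.adicCompletion E)) (H⁻¹ i j)) :
    letI := starRingOfQuadratic (finrank_adicCompletion_eq_two E v w hmap) σ hσ
    ∃ P : Matrix (Fin 3) (Fin 3) (w.adicCompletion E),
      (∀ i j, IsLocalization.IsInteger
        (integralClosure (v.adicCompletionIntegers (maximalRealSubfield E)) (w.adicCompletion E)) (P i j)) ∧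
      IsRUnit (integralClosure (v.adicCompletionIntegers (maximalRealSubfield E)) (w.adicCompletion E))
        P.det ∧
      P.conjTranspose * H * P = J3 1 :=
  exists_congruent_J3_one_of_staysPrime v w (finrank_eq_two_cm E) hmap hϖ σ hσ hH hint hdet hinv

/-- **Any two self-dual lattices are `U(H)`-conjugate, for a CM field** `E` over `E⁺` at a place `v` with
`v 𝒪_E = w` — `exists_isometry_image_stdLattice_eq_of_staysPrime` with p8's T5-168 `finrank_eq_two_cm`. -/
theorem exists_isometry_image_stdLattice_eq_of_inert
    (hmap : Ideal.map (algebraMap (𝓞 (maximalRealSubfield E)) (𝓞 E)) v.asIdeal = w.asIdeal)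
    {ϖ : v.adicCompletionIntegers (maximalRealSubfield E)} (hϖ : Irreducible ϖ)
    (σ : w.adicCompletion E ≃ₐ[v.adicCompletion (maximalRealSubfield E)] w.adicCompletion E) (hσ : σ ≠ 1)
    {H : Matrix (Fin 3) (Fin 3) (w.adicCompletion E)}
    (hH : letI := starRingOfQuadratic (finrank_adicCompletion_eq_two E v w hmap) σ hσ; H.IsHermitian)
    (hdet : IsUnit H.det)
    {Q₁ Q₂ : Matrix (Fin 3) (Fin 3) (w.adicCompletion E)} (hQ₁ : IsUnit Q₁) (hQ₂ : IsUnit Q₂)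
    (h₁ : letI := starRingOfQuadratic (finrank_adicCompletion_eq_two E v w hmap) σ hσ
      dualLattice (integralClosure (v.adicCompletionIntegers (maximalRealSubfield E)) (w.adicCompletion E))
        (Q₁.conjTranspose * H * Q₁)
        (stdLattice (integralClosure (v.adicCompletionIntegers (maximalRealSubfield E))
          (w.adicCompletion E))) =
      stdLattice (integralClosure (v.adicCompletionIntegers (maximalRealSubfield E)) (w.adicCompletion E)))
    (h₂ : letI := starRingOfQuadratic (finrank_adicCompletion_eq_two E v w hmap) σ hσ
      dualLattice (integralClosure (v.adicCompletionIntegers (maximalRealSubfield E)) (w.adicCompletion E))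
        (Q₂.conjTranspose * H * Q₂)
        (stdLattice (integralClosure (v.adicCompletionIntegers (maximalRealSubfield E))
          (w.adicCompletion E))) =
      stdLattice (integralClosure (v.adicCompletionIntegers (maximalRealSubfield E)) (w.adicCompletion E))) :
    letI := starRingOfQuadratic (finrank_adicCompletion_eq_two E v w hmap) σ hσ
    ∃ g : Matrix (Fin 3) (Fin 3) (w.adicCompletion E), g.conjTranspose * H * g = H ∧
      (fun x => g *ᵥ x) '' ((fun x => Q₂ *ᵥ x) ''
          stdLattice (integralClosure (v.adicCompletionIntegers (maximalRealSubfield E))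
            (w.adicCompletion E))) =
        (fun x => Q₁ *ᵥ x) ''
          stdLattice (integralClosure (v.adicCompletionIntegers (maximalRealSubfield E))
            (w.adicCompletion E)) :=
  exists_isometry_image_stdLattice_eq_of_staysPrime v w (finrank_eq_two_cm E) hmap hϖ σ hσ hH hdet hQ₁ hQ₂
    h₁ h₂

end CM

/-! ## CM fields, the place sorted by the Legendre symbol: `x² = d`, `4d ∉ v`, `d` a non-square mod `v` -/

section Legendre

variable (E : Type*) [Field E] [NumberField E] [IsCMField E]
variable {x : 𝓞 E} {d : 𝓞 (maximalRealSubfield E)} (v : HeightOneSpectrum (𝓞 (maximalRealSubfield E)))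
variable (hx : x * x = algebraMap (𝓞 (maximalRealSubfield E)) (𝓞 E) d)
  (hx' : x ∉ Set.range (algebraMap (𝓞 (maximalRealSubfield E)) (𝓞 E)))
  (hv : 4 * d ∉ v.asIdeal) (hd : ¬ IsSquare (Ideal.Quotient.mk v.asIdeal d))
variable (w : HeightOneSpectrum (𝓞 E)) [w.asIdeal.LiesOver v.asIdeal]

include hx hx' hv hd in
/-- **The normal form `antidiag(1, 1, 1)` from the Legendre symbol**: for a CM field `E = E⁺(x)`, `x² = d`, at a
place `v` of `E⁺` with `4d ∉ v` and `d` a non-square mod `v` (so `v 𝒪_E = w` by p8's T5-179 `map_eq_asIdeal`),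
every unimodular `σ`-hermitian `3 × 3` `H` over `E_w` is `Pᴴ H P = antidiag(1, 1, 1)` with `P ∈ GL₃(𝒪_{E_v})`. -/
theorem exists_congruent_J3_one_of_not_isSquare
    {ϖ : v.adicCompletionIntegers (maximalRealSubfield E)} (hϖ : Irreducible ϖ)
    (σ : w.adicCompletion E ≃ₐ[v.adicCompletion (maximalRealSubfield E)] w.adicCompletion E) (hσ : σ ≠ 1)
    {H : Matrix (Fin 3) (Fin 3) (w.adicCompletion E)}
    (hH : letI := starRingOfQuadratic (T5CMCensusPackage.finrank_adicCompletion_eq_two E v hx hx' hv hd w) σ hσ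
      H.IsHermitian)
    (hint : ∀ i j, IsLocalization.IsInteger
      (integralClosure (v.adicCompletionIntegers (maximalRealSubfield E)) (w.adicCompletion E)) (H i j))
    (hdet : IsUnit H.det)
    (hinv : ∀ i j, IsLocalization.IsInteger
      (integralClosure (v.adicCompletionIntegers (maximalRealSubfield E)) (w.adicCompletion E)) (H⁻¹ i j)) :
    letI := starRingOfQuadratic (T5CMCensusPackage.finrank_adicCompletion_eq_two E v hx hx' hv hd w) σ hσ
    ∃ P : Matrix (Fin 3) (Fin 3) (w.adicCompletion E),
      (∀ i j, IsLocalization.IsInteger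
        (integralClosure (v.adicCompletionIntegers (maximalRealSubfield E)) (w.adicCompletion E)) (P i j)) ∧
      IsRUnit (integralClosure (v.adicCompletionIntegers (maximalRealSubfield E)) (w.adicCompletion E))
        P.det ∧
      P.conjTranspose * H * P = J3 1 :=
  exists_congruent_J3_one_of_inert E v w (T5CMCensusPackage.map_eq_asIdeal E v hx hx' hv hd w) hϖ σ hσ hH hint
    hdet hinv

include hx hx' hv hd in
/-- **Any two self-dual lattices are `U(H)`-conjugate, from the Legendre symbol** (`4d ∉ v`, `d` a non-square
mod `v`) — `exists_isometry_image_stdLattice_eq_of_inert` on p8's T5-179 `map_eq_asIdeal`. -/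
theorem exists_isometry_image_stdLattice_eq_of_not_isSquare
    {ϖ : v.adicCompletionIntegers (maximalRealSubfield E)} (hϖ : Irreducible ϖ)
    (σ : w.adicCompletion E ≃ₐ[v.adicCompletion (maximalRealSubfield E)] w.adicCompletion E) (hσ : σ ≠ 1)
    {H : Matrix (Fin 3) (Fin 3) (w.adicCompletion E)}
    (hH : letI := starRingOfQuadratic (T5CMCensusPackage.finrank_adicCompletion_eq_two E v hx hx' hv hd w) σ hσ
      H.IsHermitian)
    (hdet : IsUnit H.det)
    {Q₁ Q₂ : Matrix (Fin 3) (Fin 3) (w.adicCompletion E)} (hQ₁ : IsUnit Q₁) (hQ₂ : IsUnit Q₂)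
    (h₁ : letI := starRingOfQuadratic (T5CMCensusPackage.finrank_adicCompletion_eq_two E v hx hx' hv hd w) σ hσ
      dualLattice (integralClosure (v.adicCompletionIntegers (maximalRealSubfield E)) (w.adicCompletion E))
        (Q₁.conjTranspose * H * Q₁)
        (stdLattice (integralClosure (v.adicCompletionIntegers (maximalRealSubfield E))
          (w.adicCompletion E))) =
      stdLattice (integralClosure (v.adicCompletionIntegers (maximalRealSubfield E)) (w.adicCompletion E)))
    (h₂ : letI := starRingOfQuadratic (T5CMCensusPackage.finrank_adicCompletion_eq_two E v hx hx' hv hd w) σ hσ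
      dualLattice (integralClosure (v.adicCompletionIntegers (maximalRealSubfield E)) (w.adicCompletion E))
        (Q₂.conjTranspose * H * Q₂)
        (stdLattice (integralClosure (v.adicCompletionIntegers (maximalRealSubfield E))
          (w.adicCompletion E))) =
      stdLattice (integralClosure (v.adicCompletionIntegers (maximalRealSubfield E)) (w.adicCompletion E))) :
    letI := starRingOfQuadratic (T5CMCensusPackage.finrank_adicCompletion_eq_two E v hx hx' hv hd w) σ hσ
    ∃ g : Matrix (Fin 3) (Fin 3) (w.adicCompletion E), g.conjTranspose * H * g = H ∧
      (fun y => g *ᵥ y) '' ((fun y => Q₂ *ᵥ y) ''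
          stdLattice (integralClosure (v.adicCompletionIntegers (maximalRealSubfield E))
            (w.adicCompletion E))) =
        (fun y => Q₁ *ᵥ y) ''
          stdLattice (integralClosure (v.adicCompletionIntegers (maximalRealSubfield E))
            (w.adicCompletion E)) :=
  exists_isometry_image_stdLattice_eq_of_inert E v w (T5CMCensusPackage.map_eq_asIdeal E v hx hx' hv hd w) hϖ σ hσ
    hH hdet hQ₁ hQ₂ h₁ h₂

end Legendre

end Summit.Ventures.HodgeRepro2.T5InertSelfDualGlobal
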